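import Summits.QuantumFields.YangMills.Theorems.BalabanUVNodesN12AtRecord
import Summits.QuantumFields.YangMills.Theorems.BalabanUVNodesN06AtRecord9CB10Y
import Literature.MathematicalPhysics.QuantumFieldTheory.Balaban1983to89.Node00.Record12CarriersRecords

/-!
# BalabanUVNodes ∕ N12 AT THE STAGE-12 RECORD WITH THE [IV] BUNDLE PINNED, `Node00.IsRecordOfRecord₁₂CB10YZW` (and its five-pin sequel `…₁₂CB10YZWB8`) —
# the stub `YMDAG.UVSplit.S_N12 Rec := AtRecord Rec Dag.B15_main` READ, KEYED and CLOSED BY NAME at def-T's REPAIRED record `Record12` (v2–v2.2, p458710 ∕ p459432: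
# §2 [III] format pins repaired, 𝐓-weights PINNED per run, level-0 background a theorem, `Provisos₁₁`'s uninhabitable `alphaPos` dropped) ∕ node00-def g32's
# `Record12Carriers(Records)`: the `rBasicStep` leaf IS `B15Leaf (WOfRecord₁₂ θ λ P)`; the KEYED closers deliver `Dag.B15_main (leavesP w P)` from the DISPLAYED
# hypotheses `Node00.WDisplays₁₀ θ.toStage9Params λ P`; the census twin: in ∀-form over the record predicate the leaf is JUNK-REFUTABLE through the residual letters
# (Track A, DAG node N12 = [B15, Balaban1989LargeFieldI] CMP 122 (1989) 175, basic step of 𝐑 (0.1)–(0.6) p.176, Prop. 1 p.194, (1.80), (1.89), (1.99)–(1.102); cluster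
# K1 ∕ K1′ `StabilityBAtRecordR11e → R12e`; seat `pub-ymgap-dag-n12-d` g2 (R134 fan-out, strategy s2), 2026-08-26; count-neutral)

WHY THIS MODULE (11 ↦ 12).  This seat's Stage-11 module `BalabanUVNodesN12AtRecord11CB10YZW` (p450999) is keyed at `IsRecordOfRecord₁₁CB10YZW`, whose packages carry
`θ.Provisos₁₁` — UNINHABITED in the kernel (def-T's `Record12.not_provisos₁₁`), so every ₁₁-keyed closer is VACUOUS.  `Record12` repairs the provisos and PINS the
𝐓-weights per run; the route (rev 13) re-keys K0′–K3′ θ-keyed over `Record12` (director LINE №81 (3): «every ₁₁ module re-instantiates at ₁₂»).  This file is that re-instantiation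
for N12, BY NAME (`Stage12Params`, `θ.Admissible F N`, `Provisos₁₂ F N`, `datumOfRecord₁₂`, `view₁₂…`, `WOfRecord₁₂ := WOfRecord₁₀ ∘ toStage9Params` — g32's `rfl`); the [IV]
bundle and its displays are Stage-10 objects of the Stage-9 part and DO NOT read the pinned 𝐓-weights or the §2 data.

HONEST FRAMING.  Count-neutral kernel BOOKKEEPING BY NAME over `Node00.Record12CarriersRecords` + `Node00.Record12Carriers` (node00-def g32: `IsRecordOfRecord₁₂CB10YZW(B8)`,
`leaves_iff_of_…`, `isRecordOfRecord₁₂C_of_…`, `…_rebind_of_isRecordOfRecord₁₂C`, `b4_b5_b6_b7_of_…B8`, the five views `view₁₂…` and their `…_leaves`, `WOfRecord₁₂`),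
`Node00.Record12` (def-T: `IsRecordOfRecord₁₂C`, transferred in-edges `b4∕b5∕b7_main_of_isRecordOfRecord₁₂C`), `Node00.CarriersW` (`ResidW`, `WDisplays₁₀`,
`b15Leaf_WOfRecord₁₀_of_displays`, `not_b15Leaf_WOfRecord₁₀_swapLF`, `nonempty_residW`), the N06 seat's Stage-9 lemma `exists_junkOps_b9LeafX_Y9OfRecord` (only to pass
inhabitation ₁₂C → ₁₂CB10YZW), and this node's closer-of-record module `BalabanUVNodesN12AtRecord` (p419528: `S_N12`, `s_N12_antitone`, `s_N12_of_refines₅C_WOfTower9`).  NOT A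
DISCHARGE OF N12: every closer of §2 takes AS HYPOTHESES, keyed to the packages presenting the record, the [IV] displays `WDisplays₁₀` — Proposition 1 (1.78) on the residual
carrier `λ.LF P`, (1.80) ∕ (1.89) for the residual letters `λ.D189 P`, (1.102) for the residual 𝐑′-data `λ.D1100 P`, the p.176 provisos on the pre-𝐑 terms in the (R-C2) MASS
reading — TYPED, NOT ASSERTED; §3 proves the ∀-form of the leaf over the record predicate FALSE as soon as the predicate is inhabited.  Inhabitation of `IsRecordOfRecord₁₂C`
(K0′) is neither proved nor assumed (`hex`).  One step `k := λ.kSel P` per run, as the presenting package says.  The in-edge guards `b5`, `b7` are def-T's transferred NODE 00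
theorems (kept `private`: the N08 seat's Stage-12 module owns the public four-guard name).  Nothing of Bałaban's asserted; one finite four-torus programme at fixed `ε`;
nothing continuum ∕ ℝ⁴ ∕ OS ∕ mass gap ∕ Clay.  0 `sorry`, 0 `def`, 0 `instance`, standard axioms.  Filed `--supports` K1′ `StabilityBAtRecordR12e` (stmt-QuantumFields-19790, rev 13; the ₁₁ K1 19674 is aside).

WHAT THIS FILE PROVES.
* §1 READING — `leaf_rBasicStep_iff_of_isRecordOfRecord₁₂CB10YZW(B8)` (`rBasicStep ↔ B15Leaf (WOfRecord₁₂ θ λ P)`), `b15_main_iff_residual_of_…` (`Dag.B15_main ⟺ (b8 → b10 →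
  b11 → rBasicStep)`), the faces through the pinned bundles `b15_main_iff_bundles_of_…(B8)`, `s_N12_iff₁₂CB10YZW_bundles`.
* §2 KEYED CLOSERS BY NAME — pointed, at ALL FIVE of g32's Stage-12 views (`b15_main_of_up_view₁₂B10YZW_of_displays` ∕ `…B8B10YZW…` ∕ `…B12B8B10YZW…` ∕ `…B8subB10YZW…` ∕
  `…B12B8subB10YZW…` — the forms a ONE-WORLD ∃-assembly of `DagBinding.Nodes` consumes), per record (`…_of_slots ∕ _of_displays`), for every `Rec` refining the predicate
  (`s_N12_of_refines₁₂CB10YZW(B8)_of_displays`), THE JUNCTION with n12-a's hook (`view₁₂B10YZW_res_W` `rfl`; `s_N12_of_refines₁₂CB10YZW_via_WOfTower9` = ONE APPLICATION of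
  `N12AtRecord.s_N12_of_refines₅C_WOfTower9`), `s_N12_record₁₂CB10YZW_of_s_N12_record₁₂C` (antitone).
* §3 CENSUS TWIN — `isRecordOfRecord₁₂CB10YZW_reLayerW`, `not_b15Leaf_WOfRecord₁₂_swapLF`, `not_atRecord_rBasicStep₁₂CB10YZW ∕ ₁₂C` (under `hex`).
* §4 GUARD — `b15Leaf_of_s_N12_record₁₂CB10YZW` (under `S_N12` the leaf is read back at every presented package: §2 proves nothing weaker than the slot).
Sources: [Balaban1989LargeFieldI] (0.2)–(0.6) p.176, Prop. 1 (1.78) p.194, (1.80) p.195, (1.89) p.198, (1.99)–(1.102) pp.200–201; record dictionaries [Balaban1988Convergent]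
(2.18) p.257, (2.21) p.258, (3.25) p.270, [Balaban1989LargeFieldII] Thm 1 + (0.1) pp.355–356. -/

noncomputable section

open MeasureTheory

namespace Summit.QuantumFields.YangMills.BalabanUVNodes.N12AtRecord12CB10YZW

open Literature.MathematicalPhysics.QuantumFieldTheory.Balaban1983to89
open Literature.MathematicalPhysics.QuantumFieldTheory.Balaban1983to89.T4Continuum (T4Family FiniteEpsData)
open Literature.MathematicalPhysics.QuantumFieldTheory.Balaban1983to89.DagBinding (WorldP leavesP PrintedCarriers15 B15Leaf B9LeafX B11Leaf)
open Literature.MathematicalPhysics.QuantumFieldTheory.Balaban1983to89.Node00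
open YMDAG.UVSplit (RecordPred Datum AtRecord S_N12)
open Summit.QuantumFields.YangMills.BalabanUVNodes.N12AtRecord (s_N12_antitone s_N12_of_refines₅C_WOfTower9)
open Summit.QuantumFields.YangMills.BalabanUVNodes.N06AtRecord9CB10Y (exists_junkOps_b9LeafX_Y9OfRecord)

variable {N : ℕ} [NeZero N]

/-! ## §1 READING — the N12 socket at ₁₂, the in-edge guards, the residual reading, the face through the pinned bundles -/

section Reading
variable {F : T4Family} {D : Datum F N} {w : WorldP}

/-- **THE N12 SOCKET AT A STAGE-12 RECORD WITH THE [IV] BUNDLE PINNED**: for one package presenting `(D, w)`, at every run the `rBasicStep` leaf IS the [IV] leaf at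
the bundle of record `WOfRecord₁₂ θ λ P` (n12-a's `WOfRepr` at `Tstep rep_k` of the tower of record, `k := λ.kSel P`; g32's `leaves_iff_of_…` BY NAME). [cite: Balaban1989LargeFieldI, Prop. 1 p.194, (0.4)–(0.6) p.176, (1.89) p.198, (1.102) p.201 (the leaf at the objects of record; bookkeeping)] -/
theorem leaf_rBasicStep_iff_of_isRecordOfRecord₁₂CB10YZW (h : IsRecordOfRecord₁₂CB10YZW F N D w) :
    ∃ (θ : Stage12Params F N) (lamW : ResidW F N), θ.Admissible F N ∧
      ∀ P : B12.RunParams, (leavesP w P).rBasicStep ↔ B15Leaf (WOfRecord₁₂ F N θ lamW P) := by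
  obtain ⟨θ, _, _, _, lamW, hθ, -, hl⟩ := leaves_iff_of_isRecordOfRecord₁₂CB10YZW h
  exact ⟨θ, lamW, hθ, fun P => (hl P).1⟩

/-- **The same socket at the five-pin record** (`…B8`, the S-binding; g32's `leaves_iff_of_isRecordOfRecord₁₂CB10YZWB8` BY NAME).
[cite: Balaban1989LargeFieldI, Prop. 1 p.194, (0.4)–(0.6) p.176 (bookkeeping)] -/
theorem leaf_rBasicStep_iff_of_isRecordOfRecord₁₂CB10YZWB8 (h : IsRecordOfRecord₁₂CB10YZWB8 F N D w) :
    ∃ (θ : Stage12Params F N) (lamW : ResidW F N), θ.Admissible F N ∧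
      ∀ P : B12.RunParams, (leavesP w P).rBasicStep ↔ B15Leaf (WOfRecord₁₂ F N θ lamW P) := by
  obtain ⟨θ, _, _, _, _, lamW, hθ, -, hl⟩ := leaves_iff_of_isRecordOfRecord₁₂CB10YZWB8 h
  exact ⟨θ, lamW, hθ, fun P => (hl P).2.1⟩

/-- The in-edge guards of `Dag.B15_main` at a ₁₂CB10YZW record: `b5` ([B5], N02), `b7` ([B7], N04) are NODE 00's theorems transferred by def-T along g32's refinement
(private: the N08 seat's Stage-12 module carries the public four-guard name). [cite: Balaban1984PropagatorsI, Props. 1.1–1.2 pp.33–36; Balaban1985Averaging, Props. 1–10 pp.26–50 (kernel versions, transferred; bookkeeping)] -/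
private theorem b5_b7_of_isRecordOfRecord₁₂CB10YZW (h : IsRecordOfRecord₁₂CB10YZW F N D w) (P : B12.RunParams) :
    (leavesP w P).b5 ∧ (leavesP w P).b7 := by
  have h' := isRecordOfRecord₁₂C_of_isRecordOfRecord₁₂CB10YZW h
  have h5 : (leavesP w P).b5 := b5_main_of_isRecordOfRecord₁₂C h' P (b4_main_of_isRecordOfRecord₁₂C h' P)
  exact ⟨h5, b7_main_of_isRecordOfRecord₁₂C h' P h5⟩

/-- **N12 at a ₁₂CB10YZW record, the RESIDUAL READING**: at every run `Dag.B15_main ⟺ (b8 → b10 → b11 → rBasicStep)` — the discharged in-edges `b5`, `b7` drop out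
(NODE 00's N02 ∕ N04 at the Stage-5 shadow, transferred by def-T), so no closer below is vacuous through an in-edge. [cite: Balaban1989LargeFieldI, Prop. 1 p.194, (0.2)–(0.6) p.176 (the node's shape `Dag.B15_main`; bookkeeping)] -/
theorem b15_main_iff_residual_of_isRecordOfRecord₁₂CB10YZW (h : IsRecordOfRecord₁₂CB10YZW F N D w) (P : B12.RunParams) :
    Dag.B15_main (leavesP w P) ↔ ((leavesP w P).b8 → (leavesP w P).b10 → (leavesP w P).b11 → (leavesP w P).rBasicStep) := by
  obtain ⟨h5, h7⟩ := b5_b7_of_isRecordOfRecord₁₂CB10YZW h P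
  exact ⟨fun H h8 h10 h11 => H h5 h7 h8 h10 h11, fun H _ _ h8 h10 h11 => H h8 h10 h11⟩

/-- **THE FACE AT ₁₂ THROUGH THE PINNED BUNDLES**: for one package `(θ, ζ, λ)` presenting the record, at every run
`Dag.B15_main ⟺ (b8 → PrintedUV3V N θ.L → B11Leaf (Z11OfRecord F N ζ) → B15Leaf (WOfRecord₁₂ F N θ λ P))` — `b10` ([B10], N08), `b11` ([B11], N07) are the PINNED bundle
leaves, `b8` ([B8], unpinned here) stays a world leaf, the conclusion is the [IV] leaf at the bundle of record. [cite: Balaban1989LargeFieldI, Prop. 1 p.194, (0.4)–(0.6) p.176; Balaban1985UV3, Thm 1 p.257; Balaban1985Variational, Thm 1 p.279 (the pinned objects; bookkeeping)] -/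
theorem b15_main_iff_bundles_of_isRecordOfRecord₁₂CB10YZW (h : IsRecordOfRecord₁₂CB10YZW F N D w) :
    ∃ (θ : Stage12Params F N) (ζ : ResidZ F N) (lamW : ResidW F N), θ.Admissible F N ∧ w.L = (θ.L : ℝ) ∧
      ∀ P : B12.RunParams,
        (Dag.B15_main (leavesP w P) ↔
          ((leavesP w P).b8 → PrintedUV3V N θ.L → B11Leaf (Z11OfRecord F N ζ) → B15Leaf (WOfRecord₁₂ F N θ lamW P))) := by
  obtain ⟨θ, _, _, ζ, lamW, hθ, hL, hl⟩ := leaves_iff_of_isRecordOfRecord₁₂CB10YZW h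
  refine ⟨θ, ζ, lamW, hθ, hL, fun P => ?_⟩
  rw [b15_main_iff_residual_of_isRecordOfRecord₁₂CB10YZW h P, (hl P).1, (hl P).2.2.1, (hl P).2.2.2]

/-- **The five-pin face** (`…₁₂CB10YZWB8`, package `(θ, lam8, ζ, λ)`): at every run `Dag.B15_main ⟺ (B8LeafOfRecord θ₃ lam8 → PrintedUV3V N θ.L → B11Leaf (Z11OfRecord F N ζ)
→ B15Leaf (WOfRecord₁₂ F N θ λ P))` — all leaves pinned (g32's `leaves_iff_of_isRecordOfRecord₁₂CB10YZWB8`, `b4_b5_b6_b7_of_…`). [cite: Balaban1989LargeFieldI, Prop. 1 p.194; Balaban1985RegularSpaces, Thm 2 p.83; Balaban1985UV3, Thm 1 p.257; Balaban1985Variational, Thm 1 p.279 (bookkeeping)] -/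
theorem b15_main_iff_bundles_of_isRecordOfRecord₁₂CB10YZWB8 (h : IsRecordOfRecord₁₂CB10YZWB8 F N D w) :
    ∃ (θ : Stage12Params F N) (lam : ResidB8 θ.toStage3Params) (ζ : ResidZ F N) (lamW : ResidW F N),
      θ.Admissible F N ∧ w.L = (θ.L : ℝ) ∧ ∀ P : B12.RunParams,
        (Dag.B15_main (leavesP w P) ↔
          (B8LeafOfRecord θ.toStage3Params lam → PrintedUV3V N θ.L → B11Leaf (Z11OfRecord F N ζ) → B15Leaf (WOfRecord₁₂ F N θ lamW P))) := by
  obtain ⟨θ, lam, _, _, ζ, lamW, hθ, hL, hl⟩ := leaves_iff_of_isRecordOfRecord₁₂CB10YZWB8 h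
  refine ⟨θ, lam, ζ, lamW, hθ, hL, fun P => ?_⟩
  obtain ⟨-, h5, -, h7⟩ := b4_b5_b6_b7_of_isRecordOfRecord₁₂CB10YZWB8 h P
  have hres : Dag.B15_main (leavesP w P) ↔ ((leavesP w P).b8 → (leavesP w P).b10 → (leavesP w P).b11 → (leavesP w P).rBasicStep) :=
    ⟨fun H h8 h10 h11 => H h5 h7 h8 h10 h11, fun H _ _ h8 h10 h11 => H h8 h10 h11⟩
  rw [hres, (hl P).1, (hl P).2.1, (hl P).2.2.2.1, (hl P).2.2.2.2]

end Reading

/-- **`S_N12` AT THE STAGE-12 W-PINNED RECORD, EXACTLY**: ⟺ «for every package `(θ, h, Mstar, ops, ζ, λ)` of an admissible Stage-12 parameter with its provisos and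
every world bound over the four-pin view (datum `datumOfRecord₁₂ F N θ h`, window `0 < γ ≤ θ.γ`, block size `θ.L`), at every run: `b8 → PrintedUV3V N θ.L →
B11Leaf (Z11OfRecord F N ζ) → B15Leaf (WOfRecord₁₂ F N θ λ P)`» — neither the in-edges nor the [IV] leaf are claimed. [cite: Balaban1989LargeFieldI, Prop. 1 p.194, (0.2)–(0.6) p.176; Balaban1989LargeFieldII, Thm 1 + (0.1) pp.355–356 (bookkeeping)] -/
theorem s_N12_iff₁₂CB10YZW_bundles :
    S_N12 (fun F D w => IsRecordOfRecord₁₂CB10YZW F N D w) ↔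
      ∀ (F : T4Family) (θ : Stage12Params F N) (h : θ.Provisos₁₂ F N) (Mstar : ℕ) (ops : OpsY N θ.toStage3Params Mstar) (ζ : ResidZ F N)
        (lamW : ResidW F N) (w : WorldP), θ.Admissible F N → w.C = (datumOfRecord₁₂ F N θ h).C → (0 < w.γ ∧ w.γ ≤ θ.γ) → w.L = (θ.L : ℝ) →
        (∀ P, w.up P = upOfRecord₅C F N (θ.view₁₂B10YZW F N Mstar ops ζ lamW) P) →
          ∀ P : B12.RunParams, (leavesP w P).b8 → PrintedUV3V N θ.L → B11Leaf (Z11OfRecord F N ζ) → B15Leaf (WOfRecord₁₂ F N θ lamW P) := by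
  refine ⟨fun hS F θ hP Mstar ops ζ lamW w hθ hC hγ hL hup P h8 h10 h11 => ?_, fun H F D w h P => ?_⟩
  · have hrec : IsRecordOfRecord₁₂CB10YZW F N (datumOfRecord₁₂ F N θ hP) w := ⟨θ, hP, Mstar, ops, ζ, lamW, hθ, rfl, hC, hγ, hL, hup⟩
    have hl := upOfRecord₅C_view₁₂B10YZW_leaves F N θ Mstar ops ζ lamW P
    obtain ⟨h5, h7⟩ := b5_b7_of_isRecordOfRecord₁₂CB10YZW hrec P
    have h10' : (leavesP w P).b10 := by
      show (w.up P).b10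
      rw [hup P]; exact hl.2.2.1.2 h10
    have h11' : (leavesP w P).b11 := by
      show (w.up P).b11
      rw [hup P]; exact hl.2.2.2.2 h11
    have hr : (leavesP w P).rBasicStep := hS F _ w hrec P h5 h7 h8 h10' h11'
    have hr' : (w.up P).rBasicStep := hr
    rw [hup P] at hr'
    exact hl.1.1 hr'
  · obtain ⟨θ, hP, Mstar, ops, ζ, lamW, hθ, hD, hC, hγ, hL, hup⟩ := h
    subst hD
    have hl := upOfRecord₅C_view₁₂B10YZW_leaves F N θ Mstar ops ζ lamW P
    intro _ _ h8 h10 h11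
    have h10' : PrintedUV3V N θ.L := by
      have : (w.up P).b10 := h10
      rw [hup P] at this; exact hl.2.2.1.1 this
    have h11' : B11Leaf (Z11OfRecord F N ζ) := by
      have : (w.up P).b11 := h11
      rw [hup P] at this; exact hl.2.2.2.1 this
    show (w.up P).rBasicStep
    rw [hup P]
    exact hl.1.2 (H F θ hP Mstar ops ζ lamW w hθ hC hγ hL hup P h8 h10' h11')

/-! ## §2 KEYED CLOSERS BY NAME — from the DISPLAYED [IV] hypotheses `Node00.WDisplays₁₀` at the presenting packages, nothing else -/

section Closers
variable {F : T4Family} {D : Datum F N} {w : WorldP}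

/-- **The [IV] leaf at the Stage-12 bundle of record FROM THE DISPLAYS** (g30's `b15Leaf_WOfRecord₁₀_of_displays` at `θ.toStage9Params`; (0.4) ∕ (0.6) are n12-a's
THEOREMS `B15LeafKnitTower9.b15Leaf_WOfTower9_of_mass`, the four printed statements displayed). [cite: Balaban1989LargeFieldI, (0.2)–(0.6) p.176, Prop. 1 (1.78) p.194, (1.80) p.195, (1.89) p.198, (1.102) p.201] -/
theorem b15Leaf_WOfRecord₁₂_of_displays {θ : Stage12Params F N} {lamW : ResidW F N} {P : B12.RunParams} (hd : WDisplays₁₀ θ.toStage9Params lamW P) :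
    B15Leaf (WOfRecord₁₂ F N θ lamW P) :=
  b15Leaf_WOfRecord₁₀_of_displays hd

/-- **POINTED CLOSER, four-pin view** (no record hypothesis): a world bound at run `P` over the four-pin Stage-12 view `θ.view₁₂B10YZW Mstar ops ζ λ` satisfies
`Dag.B15_main` at `P` as soon as the [IV] displays hold at `(θ.toStage9Params, λ, P)` — in-edges unused. [cite: Balaban1989LargeFieldI, Prop. 1 (1.78) p.194, (0.2)–(0.6) p.176, (1.80) p.195, (1.89) p.198, (1.102) p.201] -/
theorem b15_main_of_up_view₁₂B10YZW_of_displays (θ : Stage12Params F N) (Mstar : ℕ) (ops : OpsY N θ.toStage3Params Mstar) (ζ : ResidZ F N)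
    (lamW : ResidW F N) {P : B12.RunParams} (hup : w.up P = upOfRecord₅C F N (θ.view₁₂B10YZW F N Mstar ops ζ lamW) P)
    (hd : WDisplays₁₀ θ.toStage9Params lamW P) : Dag.B15_main (leavesP w P) := by
  intro _ _ _ _ _
  show (w.up P).rBasicStep
  rw [hup]
  exact (upOfRecord₅C_view₁₂B10YZW_leaves F N θ Mstar ops ζ lamW P).1.2 (b15Leaf_WOfRecord₁₂_of_displays hd)

/-- **POINTED CLOSER, five-pin view** (S-binding; no record hypothesis). [cite: Balaban1989LargeFieldI, Prop. 1 (1.78) p.194, (0.2)–(0.6) p.176, (1.80) p.195, (1.89) p.198, (1.102) p.201] -/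
theorem b15_main_of_up_view₁₂B8B10YZW_of_displays (θ : Stage12Params F N) (lam : ResidB8 θ.toStage3Params) (Mstar : ℕ) (ops : OpsY N θ.toStage3Params Mstar)
    (ζ : ResidZ F N) (lamW : ResidW F N) {P : B12.RunParams} (hup : w.up P = upOfRecord₅CS F N (θ.view₁₂B8B10YZW F N lam Mstar ops ζ lamW) P)
    (hd : WDisplays₁₀ θ.toStage9Params lamW P) : Dag.B15_main (leavesP w P) := by
  intro _ _ _ _ _
  show (w.up P).rBasicStep
  rw [hup]
  exact (upOfRecord₅CS_view₁₂B8B10YZW_leaves F N θ lam Mstar ops ζ lamW P).2.1.2 (b15Leaf_WOfRecord₁₂_of_displays hd)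

/-- **POINTED CLOSER, six-pin view with [B12]** (S-binding; `WOfRecord₁₂` is blind to the [B12] pin, g32's `rfl`). [cite: Balaban1989LargeFieldI, Prop. 1 (1.78) p.194, (0.2)–(0.6) p.176, (1.80) p.195, (1.89) p.198, (1.102) p.201] -/
theorem b15_main_of_up_view₁₂B12B8B10YZW_of_displays (θ : Stage12Params F N) (lam12 : ResidB12 F N θ.τ9.M) (lam : ResidB8 θ.toStage3Params) (Mstar : ℕ)
    (ops : OpsY N θ.toStage3Params Mstar) (ζ : ResidZ F N) (lamW : ResidW F N) {P : B12.RunParams}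
    (hup : w.up P = upOfRecord₅CS F N (θ.view₁₂B12B8B10YZW F N lam12 lam Mstar ops ζ lamW) P) (hd : WDisplays₁₀ θ.toStage9Params lamW P) :
    Dag.B15_main (leavesP w P) := by
  intro _ _ _ _ _
  show (w.up P).rBasicStep
  rw [hup]
  exact (upOfRecord₅CS_view₁₂B12B8B10YZW_leaves F N θ lam12 lam Mstar ops ζ lamW P).2.2.1.2 (b15Leaf_WOfRecord₁₂_of_displays hd)

/-- **POINTED CLOSER, five-pin view with [B8′]** (S-binding at g32's sub-family [B8] group). [cite: Balaban1989LargeFieldI, Prop. 1 (1.78) p.194, (0.2)–(0.6) p.176, (1.80) p.195, (1.89) p.198, (1.102) p.201] -/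
theorem b15_main_of_up_view₁₂B8subB10YZW_of_displays (θ : Stage12Params F N) (lam : ResidB8 θ.toStage3Params) (Mstar : ℕ) (ops : OpsY N θ.toStage3Params Mstar)
    (ζ : ResidZ F N) (lamW : ResidW F N) {P : B12.RunParams} (hup : w.up P = upOfRecord₅CS F N (θ.view₁₂B8subB10YZW F N lam Mstar ops ζ lamW) P)
    (hd : WDisplays₁₀ θ.toStage9Params lamW P) : Dag.B15_main (leavesP w P) := by
  intro _ _ _ _ _
  show (w.up P).rBasicStep
  rw [hup]
  exact (upOfRecord₅CS_view₁₂B8subB10YZW_leaves F N θ lam Mstar ops ζ lamW P).2.1.2 (b15Leaf_WOfRecord₁₂_of_displays hd)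

/-- **POINTED CLOSER, six-pin view with [B12] and [B8′]** (S-binding). [cite: Balaban1989LargeFieldI, Prop. 1 (1.78) p.194, (0.2)–(0.6) p.176, (1.80) p.195, (1.89) p.198, (1.102) p.201] -/
theorem b15_main_of_up_view₁₂B12B8subB10YZW_of_displays (θ : Stage12Params F N) (lam12 : ResidB12 F N θ.τ9.M) (lam : ResidB8 θ.toStage3Params) (Mstar : ℕ)
    (ops : OpsY N θ.toStage3Params Mstar) (ζ : ResidZ F N) (lamW : ResidW F N) {P : B12.RunParams}
    (hup : w.up P = upOfRecord₅CS F N (θ.view₁₂B12B8subB10YZW F N lam12 lam Mstar ops ζ lamW) P) (hd : WDisplays₁₀ θ.toStage9Params lamW P) :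
    Dag.B15_main (leavesP w P) := by
  intro _ _ _ _ _
  show (w.up P).rBasicStep
  rw [hup]
  exact (upOfRecord₅CS_view₁₂B12B8subB10YZW_leaves F N θ lam12 lam Mstar ops ζ lamW P).2.2.1.2 (b15Leaf_WOfRecord₁₂_of_displays hd)

/-- **N12 «SLOTS» FORM at a ₁₂CB10YZW record** (the [IV] conjunct of g32's `b9_b11_b15_main_of_…_of_slots`): if every package presenting `(D, w)` has the [IV] leaf at
the bundle of record at every run, then `Dag.B15_main` holds at every run (hypothesis over the HIDDEN residual layers — why no ∀-form booking, §3). [cite: Balaban1989LargeFieldI, Prop. 1 p.194, (0.2)–(0.6) p.176 (bookkeeping)] -/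
theorem b15_main_of_isRecordOfRecord₁₂CB10YZW_of_slots (h : IsRecordOfRecord₁₂CB10YZW F N D w)
    (hW : ∀ (θ : Stage12Params F N) (hP : θ.Provisos₁₂ F N) (Mstar : ℕ) (ops : OpsY N θ.toStage3Params Mstar) (ζ : ResidZ F N) (lamW : ResidW F N),
      θ.Admissible F N → D = datumOfRecord₁₂ F N θ hP → (∀ P, w.up P = upOfRecord₅C F N (θ.view₁₂B10YZW F N Mstar ops ζ lamW) P) →
        ∀ P : B12.RunParams, B15Leaf (WOfRecord₁₂ F N θ lamW P))
    (P : B12.RunParams) : Dag.B15_main (leavesP w P) := by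
  obtain ⟨θ, hP, Mstar, ops, ζ, lamW, hθ, hD, -, -, -, hup⟩ := h
  intro _ _ _ _ _
  show (w.up P).rBasicStep
  rw [hup P]
  exact (upOfRecord₅C_view₁₂B10YZW_leaves F N θ Mstar ops ζ lamW P).1.2 (hW θ hP Mstar ops ζ lamW hθ hD hup P)

/-- **N12 OF RECORD AT A ₁₂CB10YZW RECORD, DISPLAYED-HYPOTHESES FORM** — the discharge SHAPE of N12 modulo [IV]'s printed estimates: every package presenting `(D, w)`
supplies `WDisplays₁₀ θ.toStage9Params λ P` at every run ⇒ `Dag.B15_main` at every run.  NOT a discharge. [cite: Balaban1989LargeFieldI, Prop. 1 (1.78) p.194, (0.2)–(0.6) p.176, (1.80) p.195, (1.89) p.198, (1.102) p.201] -/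
theorem b15_main_of_isRecordOfRecord₁₂CB10YZW_of_displays (h : IsRecordOfRecord₁₂CB10YZW F N D w)
    (hdisp : ∀ (θ : Stage12Params F N) (hP : θ.Provisos₁₂ F N) (Mstar : ℕ) (ops : OpsY N θ.toStage3Params Mstar) (ζ : ResidZ F N) (lamW : ResidW F N),
      θ.Admissible F N → D = datumOfRecord₁₂ F N θ hP → (∀ P, w.up P = upOfRecord₅C F N (θ.view₁₂B10YZW F N Mstar ops ζ lamW) P) →
        ∀ P : B12.RunParams, WDisplays₁₀ θ.toStage9Params lamW P)
    (P : B12.RunParams) : Dag.B15_main (leavesP w P) :=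
  b15_main_of_isRecordOfRecord₁₂CB10YZW_of_slots h
    (fun θ hP Mstar ops ζ lamW hθ hD hup Q => b15Leaf_WOfRecord₁₂_of_displays (hdisp θ hP Mstar ops ζ lamW hθ hD hup Q)) P

/-- **N12 «SLOTS» FORM at the five-pin record `…₁₂CB10YZWB8`** (S-binding). [cite: Balaban1989LargeFieldI, Prop. 1 p.194, (0.2)–(0.6) p.176 (bookkeeping)] -/
theorem b15_main_of_isRecordOfRecord₁₂CB10YZWB8_of_slots (h : IsRecordOfRecord₁₂CB10YZWB8 F N D w)
    (hW : ∀ (θ : Stage12Params F N) (hP : θ.Provisos₁₂ F N) (lam : ResidB8 θ.toStage3Params) (Mstar : ℕ) (ops : OpsY N θ.toStage3Params Mstar) (ζ : ResidZ F N)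
      (lamW : ResidW F N), θ.Admissible F N → D = datumOfRecord₁₂ F N θ hP →
        (∀ P, w.up P = upOfRecord₅CS F N (θ.view₁₂B8B10YZW F N lam Mstar ops ζ lamW) P) → ∀ P : B12.RunParams, B15Leaf (WOfRecord₁₂ F N θ lamW P))
    (P : B12.RunParams) : Dag.B15_main (leavesP w P) := by
  obtain ⟨θ, hP, lam, Mstar, ops, ζ, lamW, hθ, hD, -, -, -, hup⟩ := h
  intro _ _ _ _ _
  show (w.up P).rBasicStep
  rw [hup P]
  exact (upOfRecord₅CS_view₁₂B8B10YZW_leaves F N θ lam Mstar ops ζ lamW P).2.1.2 (hW θ hP lam Mstar ops ζ lamW hθ hD hup P)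

/-- **N12 OF RECORD AT THE FIVE-PIN RECORD, DISPLAYED-HYPOTHESES FORM.** [cite: Balaban1989LargeFieldI, Prop. 1 (1.78) p.194, (0.2)–(0.6) p.176, (1.80) p.195, (1.89) p.198, (1.102) p.201] -/
theorem b15_main_of_isRecordOfRecord₁₂CB10YZWB8_of_displays (h : IsRecordOfRecord₁₂CB10YZWB8 F N D w)
    (hdisp : ∀ (θ : Stage12Params F N) (hP : θ.Provisos₁₂ F N) (lam : ResidB8 θ.toStage3Params) (Mstar : ℕ) (ops : OpsY N θ.toStage3Params Mstar)
      (ζ : ResidZ F N) (lamW : ResidW F N), θ.Admissible F N → D = datumOfRecord₁₂ F N θ hP →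
        (∀ P, w.up P = upOfRecord₅CS F N (θ.view₁₂B8B10YZW F N lam Mstar ops ζ lamW) P) → ∀ P : B12.RunParams, WDisplays₁₀ θ.toStage9Params lamW P)
    (P : B12.RunParams) : Dag.B15_main (leavesP w P) :=
  b15_main_of_isRecordOfRecord₁₂CB10YZWB8_of_slots h
    (fun θ hP lam Mstar ops ζ lamW hθ hD hup Q => b15Leaf_WOfRecord₁₂_of_displays (hdisp θ hP lam Mstar ops ζ lamW hθ hD hup Q)) P

end Closers

/-- **`S_N12 Rec` FOR EVERY RECORD PREDICATE REFINING THE STAGE-12 W-PINNED RECORD, FROM THE DISPLAYS KEYED TO THE PRESENTING PACKAGES** (the closer a K1′ assembly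
consumes at any `Rec ⊆ ₁₂CB10YZW`; in-edges unused).  NOT-A-DISCHARGE until the displays are inhabited at the objects of record. [cite: Balaban1989LargeFieldI, Prop. 1 (1.78) p.194, (0.2)–(0.6) p.176, (1.80) p.195, (1.89) p.198, (1.102) p.201] -/
theorem s_N12_of_refines₁₂CB10YZW_of_displays (Rec : RecordPred N)
    (href : ∀ (F : T4Family) (D : Datum F N) (w : WorldP), Rec F D w → IsRecordOfRecord₁₂CB10YZW F N D w)
    (hdisp : ∀ (F : T4Family) (D : Datum F N) (w : WorldP), Rec F D w →
      ∀ (θ : Stage12Params F N) (hP : θ.Provisos₁₂ F N) (Mstar : ℕ) (ops : OpsY N θ.toStage3Params Mstar) (ζ : ResidZ F N) (lamW : ResidW F N),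
        θ.Admissible F N → D = datumOfRecord₁₂ F N θ hP → (∀ P, w.up P = upOfRecord₅C F N (θ.view₁₂B10YZW F N Mstar ops ζ lamW) P) →
          ∀ P : B12.RunParams, WDisplays₁₀ θ.toStage9Params lamW P) :
    S_N12 Rec :=
  fun F D w hR P => b15_main_of_isRecordOfRecord₁₂CB10YZW_of_displays (href F D w hR) (hdisp F D w hR) P

/-- **The same closer at the five-pin record predicate `…₁₂CB10YZWB8`** (S-binding). [cite: Balaban1989LargeFieldI, Prop. 1 (1.78) p.194, (0.2)–(0.6) p.176, (1.80) p.195, (1.89) p.198, (1.102) p.201] -/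
theorem s_N12_of_refines₁₂CB10YZWB8_of_displays (Rec : RecordPred N)
    (href : ∀ (F : T4Family) (D : Datum F N) (w : WorldP), Rec F D w → IsRecordOfRecord₁₂CB10YZWB8 F N D w)
    (hdisp : ∀ (F : T4Family) (D : Datum F N) (w : WorldP), Rec F D w →
      ∀ (θ : Stage12Params F N) (hP : θ.Provisos₁₂ F N) (lam : ResidB8 θ.toStage3Params) (Mstar : ℕ) (ops : OpsY N θ.toStage3Params Mstar) (ζ : ResidZ F N)
        (lamW : ResidW F N), θ.Admissible F N → D = datumOfRecord₁₂ F N θ hP →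
          (∀ P, w.up P = upOfRecord₅CS F N (θ.view₁₂B8B10YZW F N lam Mstar ops ζ lamW) P) → ∀ P : B12.RunParams, WDisplays₁₀ θ.toStage9Params lamW P) :
    S_N12 Rec :=
  fun F D w hR P => b15_main_of_isRecordOfRecord₁₂CB10YZWB8_of_displays (href F D w hR) (hdisp F D w hR) P

/-- **THE HOOK'S PIN CLAUSE HOLDS BY `rfl` AT THE FOUR-PIN STAGE-12 VIEW** (TS-8 coherence at ₁₂): the view's `res.W Pr` IS n12-a's `WOfRepr` at `Tstep rep_k` of the tower
of record (Stage-10 plugs of `θ.toStage9Params`), step `λ.kSel Pr`, selector ∕ fibre bonds of record, the residual letters — pinned 𝐓-weights ∕ §2 data unread. [cite: Balaban1989LargeFieldI, (0.2)–(0.6) p.176; Balaban1988Convergent, (2.18) p.257, (3.25) p.270 (bookkeeping)] -/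
theorem view₁₂B10YZW_res_W {F : T4Family} (θ : Stage12Params F N) (Mstar : ℕ) (ops : OpsY N θ.toStage3Params Mstar) (ζ : ResidZ F N) (lamW : ResidW F N)
    (Pr : B12.RunParams) :
    (θ.view₁₂B10YZW F N Mstar ops ζ lamW).res.W Pr =
      B15LeafKnitRepr.WOfRepr (repTOfRecord9 F N θ.ν θ.τ9 (EOfRecord₁₀ F N θ.toStage9Params) (wOfRecord₉ F N θ.toStage9Params) θ.ppSel Pr
          (gOfRecord₁₀ F N θ.toStage9Params Pr) (lamW.kSel Pr))
        (θ.ppSel Pr (gOfRecord₁₀ F N θ.toStage9Params Pr) (lamW.kSel Pr + 1))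
        (fibOfSeq F θ.ν θ.τ9 Pr (gOfRecord₁₀ F N θ.toStage9Params Pr) (lamW.kSel Pr + 1)) (lamW.LF Pr) (lamW.D189 Pr) (lamW.D1100 Pr) := rfl

/-- **JUNCTION — `S_N12 Rec` for `Rec ⊆ ₁₂CB10YZW` IS ONE APPLICATION OF n12-a's HOOK `N12AtRecord.s_N12_of_refines₅C_WOfTower9`**: `Θ F :=` the presenting packages,
`toS5 :=` the four-pin Stage-12 view, `Adm π :=` «`π.1` admissible and `π` presents some `Rec`-pair», `hpin := rfl` (`view₁₂B10YZW_res_W`), the eight display families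
read off the keyed `WDisplays₁₀` (same content as `s_N12_of_refines₁₂CB10YZW_of_displays`, routed through the hook by name). [cite: Balaban1989LargeFieldI, Prop. 1 (1.78) p.194, (0.2)–(0.6) p.176, (1.80) p.195, (1.89) p.198, (1.102) p.201; Balaban1988Convergent, (2.18) p.257, (3.25) p.270] -/
theorem s_N12_of_refines₁₂CB10YZW_via_WOfTower9 (Rec : RecordPred N)
    (href : ∀ (F : T4Family) (D : Datum F N) (w : WorldP), Rec F D w → IsRecordOfRecord₁₂CB10YZW F N D w)
    (hdisp : ∀ (F : T4Family) (D : Datum F N) (w : WorldP), Rec F D w →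
      ∀ (θ : Stage12Params F N) (hP : θ.Provisos₁₂ F N) (Mstar : ℕ) (ops : OpsY N θ.toStage3Params Mstar) (ζ : ResidZ F N) (lamW : ResidW F N),
        θ.Admissible F N → D = datumOfRecord₁₂ F N θ hP → (∀ P, w.up P = upOfRecord₅C F N (θ.view₁₂B10YZW F N Mstar ops ζ lamW) P) →
          ∀ P : B12.RunParams, WDisplays₁₀ θ.toStage9Params lamW P) :
    S_N12 Rec := by
  let Θ : T4Family → Type _ := fun F =>
    Σ' (θ : Stage12Params F N) (_ : θ.Provisos₁₂ F N) (Mstar : ℕ) (_ : OpsY N θ.toStage3Params Mstar) (_ : ResidZ F N), ResidW F N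
  let toS5 : ∀ F, Θ F → Stage5Params F N := fun F π => π.1.view₁₂B10YZW F N π.2.2.1 π.2.2.2.1 π.2.2.2.2.1 π.2.2.2.2.2
  let Adm : ∀ F, Θ F → Prop := fun F π => π.1.Admissible F N ∧ ∃ (D : Datum F N) (w : WorldP), Rec F D w ∧ D = datumOfRecord₁₂ F N π.1 π.2.1 ∧
    ∀ P, w.up P = upOfRecord₅C F N (toS5 F π) P
  have hd : ∀ F (π : Θ F), Adm F π → ∀ P, WDisplays₁₀ π.1.toStage9Params π.2.2.2.2.2 P := by
    rintro F ⟨θ, hP, Mstar, ops, ζ, lamW⟩ ⟨hθ, D, w, hR, hD, hup⟩ P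
    exact hdisp F D w hR θ hP Mstar ops ζ lamW hθ hD hup P
  refine s_N12_of_refines₅C_WOfTower9 Rec toS5 Adm (fun F π => π.1.ν) (fun F π => π.1.τ9) (fun F π => EOfRecord₁₀ F N π.1.toStage9Params)
    (fun F π => wOfRecord₉ F N π.1.toStage9Params) (fun F π => π.1.ppSel) (fun F π P => gOfRecord₁₀ F N π.1.toStage9Params P)
    (fun F π P => π.2.2.2.2.2.kSel P) (fun F π P => π.2.2.2.2.2.LF P) (fun F π P => π.2.2.2.2.2.D189 P) (fun F π P => π.2.2.2.2.2.D1100 P)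
    (fun F D w hR => ?_) (fun F π _ Pr => rfl)
    (fun F π h P => (hd F π h P).hm) (fun F π h P => (hd F π h P).h0) (fun F π h P => (hd F π h P).hC) (fun F π h P => (hd F π h P).hmass)
    (fun F π h P => (hd F π h P).hP1) (fun F π h P => (hd F π h P).h180) (fun F π h P => (hd F π h P).h189) (fun F π h P => (hd F π h P).h1102)
  obtain ⟨θ, hP, Mstar, ops, ζ, lamW, hθ, hD, -, -, -, hup⟩ := href F D w hR
  exact ⟨⟨θ, hP, Mstar, ops, ζ, lamW⟩, ⟨hθ, D, w, hR, hD, hup⟩, hup⟩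

/-- **`S_N12 (₁₂C) → S_N12 (₁₂CB10YZW)`** (antitone along g32's same-world refinement `isRecordOfRecord₁₂C_of_isRecordOfRecord₁₂CB10YZW`; K1′ is θ-keyed over `Record12`; ₁₂C is def-T's record predicate of record).
The converse does NOT hold by rebinding: a ₁₂C record re-binds to a ₁₂CB10YZW record with the same datum but a RE-BOUND world. [cite: Balaban1989LargeFieldII, Thm 1 + (0.1) pp.355–356 (bookkeeping)] -/
theorem s_N12_record₁₂CB10YZW_of_s_N12_record₁₂C (h : S_N12 (fun F D w => IsRecordOfRecord₁₂C F N D w)) :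
    S_N12 (fun F D w => IsRecordOfRecord₁₂CB10YZW F N D w) :=
  s_N12_antitone (fun _ _ _ hR => isRecordOfRecord₁₂C_of_isRecordOfRecord₁₂CB10YZW hR) h

/-! ## §3 CENSUS TWIN — in ∀-form over the record predicate the [IV] leaf is JUNK-REFUTABLE through the residual letters (one storey up from ₅C ∕ ₇C ∕ ₈C) -/

section Census
variable {F : T4Family} {D : Datum F N} {w : WorldP}

/-- **RE-LAYERING THE [IV] RESIDUAL DATA KEEPS THE RECORD**: a ₁₂CB10YZW record's world, re-bound over the four-pin view with ANY other [IV] layer `λ′` (same `θ`, floor,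
operator layer, [B11] layer), is again a ₁₂CB10YZW record with the SAME datum (datum, construction, window, block size are blind to `λ`). [cite: Balaban1989LargeFieldII, Thm 1 + (0.1) pp.355–356 (bookkeeping: the record predicate)] -/
theorem isRecordOfRecord₁₂CB10YZW_reLayerW (h : IsRecordOfRecord₁₂CB10YZW F N D w) :
    ∃ (θ : Stage12Params F N) (Mstar : ℕ) (ops : OpsY N θ.toStage3Params Mstar) (ζ : ResidZ F N) (lamW : ResidW F N), θ.Admissible F N ∧
      (∀ P, w.up P = upOfRecord₅C F N (θ.view₁₂B10YZW F N Mstar ops ζ lamW) P) ∧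
      ∀ lamW' : ResidW F N,
        IsRecordOfRecord₁₂CB10YZW F N D { w with up := fun P => upOfRecord₅C F N (θ.view₁₂B10YZW F N Mstar ops ζ lamW') P } := by
  obtain ⟨θ, hP, Mstar, ops, ζ, lamW, hθ, hD, hC, hγ, hL, hup⟩ := h
  exact ⟨θ, Mstar, ops, ζ, lamW, hθ, hup, fun lamW' => ⟨θ, hP, Mstar, ops, ζ, lamW', hθ, hD, hC, hγ, hL, fun _ => rfl⟩⟩

/-- The junk [IV] layer of g30's `not_b15Leaf_WOfRecord₁₀_swapLF`: the Proposition-1 carrier swapped for one with an inhabited boundary datum, `Regular ≡ ⊤` and NO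
orbits; every other residual letter kept. [cite: Balaban1989LargeFieldI, Prop. 1 (1.78) p.194 (bookkeeping: the typed conjunct reads the residual carrier)] -/
theorem not_b15Leaf_WOfRecord₁₂_swapLF (θ : Stage12Params F N) (lamW : ResidW F N) (P : B12.RunParams) :
    ¬ B15Leaf (WOfRecord₁₂ F N θ
      { lamW with LF := fun _ => ⟨PUnit, fun _ => 0, fun _ => PUnit, fun _ => PEmpty, fun _ _ _ => True, fun _ _ o => o.elim, fun _ _ o => o.elim,
        fun _ o => o.elim, fun _ _ _ => True⟩ } P) :=
  not_b15Leaf_WOfRecord₁₀_swapLF θ.toStage9Params lamW P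

/-- **CENSUS, ₁₂CB10YZW — the LEAF FORM of N12's slot over the Stage-12 W-pinned record predicate is FALSE as soon as the predicate is inhabited**: re-layer the
inhabiting record's world with the junk Proposition-1 carrier (`isRecordOfRecord₁₂CB10YZW_reLayerW`); its `rBasicStep` leaf IS `B15Leaf (WOfRecord₁₂ θ λ_junk P)`, which fails
(`not_b15Leaf_WOfRecord₁₂_swapLF`).  (R-C1) class, A2: the letters `LF ∕ D189 ∕ D1100` stay residual — N12 is closable ONLY in the keyed form of §2. [cite: Balaban1989LargeFieldI, Prop. 1 p.194 (as the leaf types it); Balaban1989LargeFieldII, Thm 1 p.355 (bookkeeping census)] -/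
theorem not_atRecord_rBasicStep₁₂CB10YZW (hex : ∃ (F : T4Family) (D : Datum F N) (w : WorldP), IsRecordOfRecord₁₂CB10YZW F N D w) :
    ¬ AtRecord (N := N) (fun F D w => IsRecordOfRecord₁₂CB10YZW F N D w) fun ℓ => ℓ.rBasicStep := by
  intro hall
  obtain ⟨F, D, w, h⟩ := hex
  obtain ⟨θ, Mstar, ops, ζ, lamW, -, -, hre⟩ := isRecordOfRecord₁₂CB10YZW_reLayerW h
  refine not_b15Leaf_WOfRecord₁₂_swapLF θ lamW ⟨0, 0, 0⟩ ((upOfRecord₅C_view₁₂B10YZW_leaves F N θ Mstar ops ζ _ ⟨0, 0, 0⟩).1.1 ?_)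
  exact hall F D _ (hre _) ⟨0, 0, 0⟩

/-- ₁₂C inhabited ⟹ ₁₂CB10YZW inhabited (rebind over the four-pin view with floor `0`, the N06 seat's junk operator layer, any [B11] ∕ [IV] layers — g32's
`isRecordOfRecord₁₂CB10YZW_rebind_of_isRecordOfRecord₁₂C`, same datum; private: the N08 seat's Stage-12 module carries the public `iff`). [cite: Balaban1989LargeFieldII, Thm 1 + (0.1) pp.355–356 (bookkeeping)] -/
private theorem inhabited₁₂CB10YZW_of_inhabited₁₂C (hex : ∃ (F : T4Family) (D : Datum F N) (w : WorldP), IsRecordOfRecord₁₂C F N D w) :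
    ∃ (F : T4Family) (D : Datum F N) (w : WorldP), IsRecordOfRecord₁₂CB10YZW F N D w := by
  obtain ⟨F, D, w, h⟩ := hex
  obtain ⟨θ, _, hθ, -, hre⟩ := isRecordOfRecord₁₂CB10YZW_rebind_of_isRecordOfRecord₁₂C h
  obtain ⟨ops, -, -⟩ := exists_junkOps_b9LeafX_Y9OfRecord (N := N) θ.toStage3Params hθ.1.1.1.1.1 0
  obtain ⟨ζ⟩ := nonempty_residZ F N
  obtain ⟨lamW⟩ := nonempty_residW F N
  exact ⟨F, D, _, hre 0 ops ζ lamW⟩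

/-- **CENSUS, ₁₂C — the leaf form over def-T's repaired record predicate is FALSE as soon as ₁₂C is inhabited** (K0′ gives the hypothesis at `N = 2`; neither proved nor
assumed here): ₁₂C inhabited ⟹ ₁₂CB10YZW inhabited, and every ₁₂CB10YZW record is a ₁₂C record at the same world (g32's refinement). [cite: Balaban1989LargeFieldI, Prop. 1 p.194; Balaban1989LargeFieldII, Thm 1 p.355 (bookkeeping census)] -/
theorem not_atRecord_rBasicStep₁₂C (hex : ∃ (F : T4Family) (D : Datum F N) (w : WorldP), IsRecordOfRecord₁₂C F N D w) :
    ¬ AtRecord (N := N) (fun F D w => IsRecordOfRecord₁₂C F N D w) fun ℓ => ℓ.rBasicStep := fun hall =>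
  not_atRecord_rBasicStep₁₂CB10YZW (inhabited₁₂CB10YZW_of_inhabited₁₂C hex)
    fun F₁ D₁ w₁ h₁ P => hall F₁ D₁ w₁ (isRecordOfRecord₁₂C_of_isRecordOfRecord₁₂CB10YZW h₁) P

end Census

/-! ## §4 GUARD — the ∀-form closer reads the slot back -/

/-- **Under `S_N12` the keyed closer is NOT vacuous and reads the slot back**: if `S_N12` holds at the W-pinned Stage-12 record predicate, then at every presenting package
and run where `b8`, `PrintedUV3V N θ.L`, `B11Leaf (Z11OfRecord ζ)` hold, the [IV] leaf `B15Leaf (WOfRecord₁₂ θ λ P)` HOLDS (§2 proves nothing weaker than the slot). [cite: Balaban1989LargeFieldI, Prop. 1 p.194, (0.2)–(0.6) p.176 (bookkeeping)] -/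
theorem b15Leaf_of_s_N12_record₁₂CB10YZW (hS : S_N12 (fun F D w => IsRecordOfRecord₁₂CB10YZW F N D w))
    {F : T4Family} (θ : Stage12Params F N) (h : θ.Provisos₁₂ F N) (Mstar : ℕ) (ops : OpsY N θ.toStage3Params Mstar) (ζ : ResidZ F N) (lamW : ResidW F N)
    {w : WorldP} (hθ : θ.Admissible F N) (hC : w.C = (datumOfRecord₁₂ F N θ h).C) (hγ : 0 < w.γ ∧ w.γ ≤ θ.γ) (hL : w.L = (θ.L : ℝ))
    (hup : ∀ P, w.up P = upOfRecord₅C F N (θ.view₁₂B10YZW F N Mstar ops ζ lamW) P) {P : B12.RunParams} (h8 : (leavesP w P).b8)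
    (h10 : PrintedUV3V N θ.L) (h11 : B11Leaf (Z11OfRecord F N ζ)) : B15Leaf (WOfRecord₁₂ F N θ lamW P) :=
  s_N12_iff₁₂CB10YZW_bundles.1 hS F θ h Mstar ops ζ lamW w hθ hC hγ hL hup P h8 h10 h11

end Summit.QuantumFields.YangMills.BalabanUVNodes.N12AtRecord12CB10YZW

end
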